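import Literature.NumberTheory.EllipticCurves.Sprung2012.ColemanMaps
import Literature.NumberTheory.EllipticCurves.SelmerCorankProofs
import Literature.NumberTheory.EllipticCurves.H1UnramifiedFinite
import Literature.Algebra.Module.PadicFunctionalSeparation
import HarnessLib

/-!
# «`r_v^ε` is injective» from ONE local statement: the Kummer condition cut out by a subgroup
# `A ≤ E(K_∞·K_v)` descends to the classical local condition at `v` as soon as the `Γ_{K_v}`-invariant
# classes of `A ⊗ ℚ_p/ℤ_p` (inside `E(K_∞·K_v) ⊗ ℚ_p/ℤ_p`) come from `E(K_v) ⊗ ℚ_p/ℤ_p` — the ENGINE of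
# INJ⁺@2 (route `ThetaPartnerAtTwo`, crux K4 `SignedControlAtTwo`, stmt-BirchSwinnertonDyer-20309, line
# `eulerchar` v4, registered stub `stub_plusLocalInjTwo`), any `K`, `p`, `κ`, `v`, `A`

Seat `prover-bsd-wall-tp2-p3-w3` (width seat 3/3 of the line's lead `prover-bsd-wall-tp2-p3`). TEMPLATE AND CREDIT:
the ♭ kernel engine `SSFlatEC.mem_localKerOver_of_layerToInfty_mem_flatLocalKummer`
(`Theorems/ByReductionTypeAtTwoSupersingularFlatLocalInjectivity.lean`, seat `bsd-2adic-ss-1` GEN 10, itself adapted from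
`Sprung2024.mem_localKerOver_of_layerToInfty_mem_sharpFlatLocalKummerOverOfEmb`, seat `bsd-ssimc-k3c5-kdot-split`):
F. Sprung, Adv. Math. 449 (2024) §5.2, proof of Lemma 5.5, case `v = p` («`r_p` is injective»), steps (1) unpack,
(2) invariance, (5) descent — with the colour-specific duality steps (3)–(4) REPLACED by one displayed hypothesis.

WHAT. `K` a number field, `W/K` elliptic data (any Weierstrass curve), `p` a prime, `κ` a `ℤ_p`-extension with layers
`K_n`, `E` a `K`-field (the completion `K_v`) with a `K`-embedding `ι : K̄ → K̄_E` (the place `𝔭` of `K_∞` above `v`),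
`M = E(K_∞·K_v)` (`localTowerPointsOfEmb κ ι W`), `M₀ = E(K_v) = E(K_0·K_v)` (`localLayerPointsOfEmb κ ι W 0`), and
`A ≤ M` ANY subgroup (meant: `A = ⋃ₙ E^ε(K_n·K_v)`, Kobayashi's signed points, or `E(K_∞·K_v)` itself).

* §2 `mem_localKerOverOfEmb_of_layerToInfty_mem_localKummerOverOfEmb_of_invariantsLift` — ASSUME
  (NT) `M` has no `p`-torsion (Sprung 2012 Lemma 2.3's conclusion; at `p = 2`, good supersingular `2`, a tree
  theorem: `SSTowerTorsion.eq_zero_of_mem_localTowerPointsOfEmb_of_two_nsmul`) and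
  (LIFT_A) **for every `x ∈ A` and `k`, if `σx − x ∈ p^k M` for all `σ ∈ Γ_{K_v}` then `x ∈ p^k M + E(K_v)`** —
  i.e. every `Γ_{K_v}`-invariant class `x ⊗ p^{-k}` of (the image of) `A ⊗ ℚ_p/ℤ_p` in `M ⊗ ℚ_p/ℤ_p` is the class
  of a point of `E(K_v)`: B. D. Kim, J. Aust. Math. Soc. 95 (2013), proof of Cor. 3.15 (p. 199) «If `v ∣ p`, `g_v` is
  injective because `E(F_v) ⊗ ℚ_p/ℤ_p = (∏_{w∣v} H^±_w)^Γ`», elementwise. THEN every class `y ∈ H¹(K, E[p^∞])`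
  whose restriction `h_0 y` to `K_∞` lies in the Kummer condition cut out by `A` at `𝔭`
  (`Kobayashi2003.localKummerOverOfEmb W p (ker κ) ι A`) dies in `H¹(Gal(K̄_v/K_v), E(K̄_v))`, i.e. satisfies the
  CLASSICAL local condition at `v` (`y ∈ W.localKerOverOfEmb p (κ.layerSubgroup 0) ι`).
* §3 `invariantsLift_of_forall_addMonoidHom_dvd` — the DUAL form of (LIFT_A) suffices: under (NT), if for every
  `x ∈ A`, `k`, `Γ_{K_v}`-invariance of `x ⊗ p^{-k}` forces `p^k ∣ z(x)` for every functional `z : M →+ ℤ_p` vanishing on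
  `E(K_v)`, then (LIFT_A) (Pontryagin separation in the `p`-torsion-free group `M/E(K_v)`,
  `Literature.Algebra.Module.exists_nsmul_eq_of_forall_addMonoidHom_padicInt_dvd` — step (4) of the template).
* §4 `localResOver_eq_zero_of_layerToInfty_mem_localKummerOver_of_invariantsLift` — the chosen-embedding form
  (`ι = closureEmb`, conclusion `W.localResOver p (κ.layerSubgroup 0) E y = 0`).

WHY (K4). With `A = ⨆ₙ E⁺(ℚ_{2,n})` this is exactly the local half of the registered stub `stub_plusLocalInjTwo`
(INJ⁺@2): the sequel file derives the stub from (LIFT_A) ALONE ((NT) is a theorem at `2`), so the `±` local theory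
at `2` that K4 needs from «`r₂⁺` injective» is ONE elementwise statement about ONE module `E(ℚ_{2,∞})` with its
`E⁺`-filtration.

HONEST FRAMING: THEOREMS ONLY (no definition, no named fact, no `sorry`), route-independent (no `Theses` import);
nothing about any curve is asserted beyond the displayed hypotheses; closes no item; BSD is not proved by any of this.

References: [Sprung2024] F. Sprung, Adv. Math. 449 (2024) 109741, §5.2 pp. 39–40; [BDKim2013] B. D. Kim, J. Aust.
Math. Soc. 95 (2013), proof of Cor. 3.15 (p. 199); [Kobayashi2003] S. Kobayashi, Invent. Math. 152 (2003), Def. 1.1,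
proof of Prop. 9.2, Thm. 9.3; [GreenbergLNM1716] R. Greenberg, LNM 1716 (1999), §2–§3 (local conditions, the maps
`r_v`); [Sprung2012] F. Sprung, J. Number Theory 132 (2012), Lemma 2.3 (p. 1487).
-/

set_option autoImplicit false
-- the Theorems namespace of this sub repeats the summit name by design (D-0017 nested layout)
set_option linter.dupNamespace false

noncomputable section

open scoped Classical NumberField

open NumberField IsDedekindDomain

universe u

namespace Summit.BirchSwinnertonDyer.BirchSwinnertonDyer.Theorems.SignedEC

open Literature.NumberTheory.EllipticCurves Literature.NumberTheory.GaloisRepresentations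
  WeierstrassCurve ZpExtension Literature.NumberTheory.EllipticCurves.Kobayashi2003
  Literature.NumberTheory.EllipticCurves.Sprung2012

variable {K : Type u} [Field K] [NumberField K] (W : WeierstrassCurve K) {p : ℕ} [Fact p.Prime]
  (κ : ZpExtension K p) (E : Type u) [Field E] [Algebra K E]

/-! ## §1 Small helpers (copied from the template, where they are private) -/

/-- The layer subgroups `Gal(K̄/K_n)` are compact. [folklore] -/
private theorem compactSpace_layerSubgroup_inj (n : ℕ) : CompactSpace (κ.layerSubgroup n) := by
  haveI : CompactSpace (Field.absoluteGaloisGroup K) := compactSpace_absoluteGaloisGroup K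
  exact isCompact_iff_compactSpace.mp
    (Subgroup.isClosed_of_isOpen _ (κ.isOpen_layerSubgroup n)).isCompact

omit [NumberField K] in
/-- No `p`-torsion ⟹ no `p`-power torsion in `E(K_∞·K_v)`. [folklore] -/
private theorem eq_zero_of_pow_smul_eq_zero_inj
    {ι : AlgebraicClosure K →ₐ[K] AlgebraicClosure E}
    (hnt : ∀ P ∈ localTowerPointsOfEmb κ ι W, p • P = 0 → P = 0)
    {m : ℕ} {P : localPoints W E} (hP : P ∈ localTowerPointsOfEmb κ ι W) (h : p ^ m • P = 0) :
    P = 0 := by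
  induction m generalizing P with
  | zero => rwa [pow_zero, one_smul] at h
  | succ m ih =>
    have h1 : p ^ m • P ∈ localTowerPointsOfEmb κ ι W := AddSubgroup.nsmul_mem _ hP _
    have h2 : p • (p ^ m • P) = 0 := by rw [← mul_smul, ← pow_succ']; exact h
    exact ih hP (hnt _ h1 h2)

omit [NumberField K] in
/-- A Galois element commutes with multiplication by `n` on local points. [folklore] -/
private theorem galois_smul_nsmul_inj (τ : Field.absoluteGaloisGroup E) (n : ℕ) (P : localPoints W E) :
    τ • (n • P) = n • (τ • P) :=
  map_nsmul (DistribSMul.toAddMonoidHom (localPoints W E) τ) n P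

/-! ## §2 The engine: «`r_v` injective on the classes Kummer-from-`A`» ⟸ (NT) + (LIFT_A) -/

/-- **«`r_v^ε` is injective» from the invariants-lift property of `A`** (Sprung 2024 §5.2, proof of Lemma 5.5 case
`v = p`, steps (1) (2) (5), with the duality steps replaced by the displayed hypothesis `hlift`; B. D. Kim 2013,
proof of Cor. 3.15: «`g_v` is injective because `E(F_v) ⊗ ℚ_p/ℤ_p = (∏_{w∣v} H^±_w)^Γ`»). Let `M = E(K_∞·K_v)`
(`localTowerPointsOfEmb κ ι W`) and `A ≤ M`. ASSUME (NT) `M` has no `p`-torsion and (LIFT_A) for every `x ∈ A` and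
`k : ℕ`, if `σ • x − x ∈ p^k • M` for every `σ ∈ Γ_{K_v}` then `x − p^k • R ∈ E(K_v)` for some `R ∈ M`. THEN every
`y ∈ H¹(K, E[p^∞])` (`= H¹(κ⁻¹(p⁰ℤ_p), E[p^∞])`) whose restriction to `K_∞` lies in the Kummer condition cut out by `A`
at the place of `ι` lies in the classical local kernel at `v`: `loc_v y = 0` in `H¹(Gal(K̄_v/K_v), E(K̄_v))`.
Proof: (1) unpack `h_0 y ∈ Kummer(A)` — a cocycle `Φ` of `y`, `Q ∈ E(K̄_v)`, `x' = p^{k'} Q₁ ∈ A` with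
`Φ = ∂Q₁` on `G_∞ = Gal(K̄_v/K_∞·K_v)` (absorbing the coboundary between the two representatives); (2) for every
`σ ∈ Γ_{K_v}`, `w_σ := σQ₁ − Q₁ − Φ(σ) ∈ M` and `σx' − x' = p^{k'} w_σ` (the `p`-power-torsion point `p^{k'}Φ(σ) ∈ M`
vanishes by (NT)); so (LIFT_A) gives `x' = p^{k'} R + x₀`, `R ∈ M`, `x₀ ∈ E(K_v)`; (5) with `Q' := Q₁ − R`,
`Φ − ∂Q'` vanishes on `G_∞`, is `M`-valued and `p`-power torsion, hence `0` by (NT): `loc_v y = ∂Q'`.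
[cite: Sprung2024, §5.2 proof of Lemma 5.5, case v = p (p. 40)] [cite: BDKim2013, proof of Cor. 3.15 (p. 199)]
[cite: Kobayashi2003, proof of Prop. 9.2 and Thm. 9.3] -/
theorem mem_localKerOverOfEmb_of_layerToInfty_mem_localKummerOverOfEmb_of_invariantsLift
    (ι : AlgebraicClosure K →ₐ[K] AlgebraicClosure E)
    (A : AddSubgroup (localPoints W E)) (hAM : A ≤ localTowerPointsOfEmb κ ι W)
    (hnt : ∀ P ∈ localTowerPointsOfEmb κ ι W, p • P = 0 → P = 0)
    (hlift : ∀ x ∈ A, ∀ k : ℕ,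
      (∀ σ : Field.absoluteGaloisGroup E, ∃ w ∈ localTowerPointsOfEmb κ ι W, σ • x - x = p ^ k • w) →
      ∃ R ∈ localTowerPointsOfEmb κ ι W, x - p ^ k • R ∈ localLayerPointsOfEmb κ ι W 0)
    {y : W.subgroupH1 p (κ.layerSubgroup 0)}
    (hy : W.layerToInfty κ 0 y ∈ localKummerOverOfEmb W p κ.kerSubgroup ι A) :
    y ∈ W.localKerOverOfEmb p (κ.layerSubgroup 0) ι := by
  -- notation
  set M : AddSubgroup (localPoints W E) := localTowerPointsOfEmb κ ι W with hM
  haveI : CompactSpace (κ.layerSubgroup 0) := compactSpace_layerSubgroup_inj κ 0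
  have hmem0 : ∀ σ : Field.absoluteGaloisGroup E, resGalOfEmb ι σ ∈ κ.layerSubgroup 0 := fun σ ↦ by
    rw [ZpExtension.layerSubgroup_zero]; exact Subgroup.mem_top _
  have hM0 : ∀ {P : localPoints W E}, P ∈ localLayerPointsOfEmb κ ι W 0 ↔
      ∀ τ : Field.absoluteGaloisGroup E, τ • P = P := fun {P} ↦ mem_localLayerPointsOfEmb_zero_iff κ ι W P
  have hMfix : ∀ {P : localPoints W E}, P ∈ M →
      ∀ τ : Field.absoluteGaloisGroup E, τ ∈ localSubgroupOfEmb κ.kerSubgroup ι → τ • P = P :=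
    fun {P} hP ↦ (mem_localTowerPointsOfEmb_iff κ ι W P).1 hP
  have hMsmul : ∀ (σ : Field.absoluteGaloisGroup E) {P : localPoints W E}, P ∈ M → σ • P ∈ M :=
    fun σ {P} hP ↦ smul_mem_localTowerPointsOfEmb κ ι W σ hP
  -- normality of `G_∞ = localSubgroupOfEmb (ker κ) ι` in `Γ_{K_v}`
  have hconj : ∀ (σ τ : Field.absoluteGaloisGroup E), τ ∈ localSubgroupOfEmb κ.kerSubgroup ι →
      σ⁻¹ * τ * σ ∈ localSubgroupOfEmb κ.kerSubgroup ι := by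
    intro σ τ hτ
    rw [mem_localSubgroupOfEmb_iff] at hτ ⊢
    rw [map_mul, map_mul, map_inv]
    exact κ.kerSubgroup_normal.conj_mem' _ hτ _
  -- Step 0: a cocycle `Φ` for `y` and its local values `f σ = ι_* Φ(res σ)`
  obtain ⟨Φ, rfl⟩ := oneCocycleClass_surjective (discreteTopRep (κ.layerSubgroup 0) (W.geomPrimaryTorsion p)) y
  set f : Field.absoluteGaloisGroup E → localPoints W E := fun σ ↦
    pointsMapOfEmb W ι ((Φ.1 ⟨resGalOfEmb ι σ, hmem0 σ⟩ : W.geomPrimaryTorsion p) : W.geomPoints)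
    with hf
  -- cocycle identity for `f`
  have hfmul : ∀ σ τ : Field.absoluteGaloisGroup E, f (σ * τ) = f σ + σ • f τ := by
    intro σ τ
    have hst : (⟨resGalOfEmb ι (σ * τ), hmem0 (σ * τ)⟩ : κ.layerSubgroup 0) =
        ⟨resGalOfEmb ι σ, hmem0 σ⟩ * ⟨resGalOfEmb ι τ, hmem0 τ⟩ := Subtype.ext (map_mul _ _ _)
    have h := Φ.2 ⟨resGalOfEmb ι σ, hmem0 σ⟩ ⟨resGalOfEmb ι τ, hmem0 τ⟩
    simp only [hf]
    rw [hst, h, AddSubgroup.coe_add, map_add, discreteTopRep_ρ_apply, Subgroup.smul_def,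
      primaryComponent.coe_smul, pointsMapOfEmb_smul]
  -- a uniform power of `p` killing `Φ` (compactness), hence `f`
  have hΦtors : ∀ h : κ.layerSubgroup 0, ∃ k : ℕ, p ^ k • Φ.1 h = 0 := fun h ↦ by
    obtain ⟨k, hk⟩ := AddCommGroup.mem_primaryComponent.mp (Φ.1 h).2
    exact ⟨k, Subtype.ext (by rw [AddSubmonoidClass.coe_nsmul, hk, ZeroMemClass.coe_zero])⟩
  obtain ⟨N, hN⟩ := exists_pow_smul_apply_eq_zero Φ.1 hΦtors
  have hfN : ∀ σ : Field.absoluteGaloisGroup E, p ^ N • f σ = 0 := by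
    intro σ
    simp only [hf]
    rw [← map_nsmul, ← AddSubmonoidClass.coe_nsmul, hN, ZeroMemClass.coe_zero, map_zero]
  -- Step 1: unpack the Kummer condition and absorb the coboundary between the two representatives
  obtain ⟨φ, Q, k, hφ, hQA, hcob⟩ := hy
  have hres : W.layerToInfty κ 0 (oneCocycleClass _ Φ) =
      oneCocycleClass _ (contOneCocycles.pullback (subgroupInclusion (κ.kerSubgroup_le_layerSubgroup 0))
        (resHomOfEquivariant (subgroupInclusion (κ.kerSubgroup_le_layerSubgroup 0))
          (AddMonoidHom.id (W.geomPrimaryTorsion p)) (fun _ _ ↦ rfl)) Φ) :=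
    map_oneCocycleClass _ _ _ Φ
  rw [hres, ← sub_eq_zero, ← oneCocycleClass_sub, oneCocycleClass_eq_zero_iff] at hφ
  obtain ⟨R₀, hR₀⟩ := hφ
  -- `φ h = Φ h + (h R₀ − R₀)` for `h ∈ ker κ`
  have hφΦ : ∀ h : κ.kerSubgroup, (φ.1 h : W.geomPrimaryTorsion p) =
      Φ.1 ⟨(h : Field.absoluteGaloisGroup K), κ.kerSubgroup_le_layerSubgroup 0 h.2⟩ +
        ((h : Field.absoluteGaloisGroup K) • R₀ - R₀) := by
    intro h
    have hpb : (contOneCocycles.pullback (subgroupInclusion (κ.kerSubgroup_le_layerSubgroup 0))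
        (resHomOfEquivariant (subgroupInclusion (κ.kerSubgroup_le_layerSubgroup 0))
          (AddMonoidHom.id (W.geomPrimaryTorsion p)) (fun _ _ ↦ rfl)) Φ).1 h =
        Φ.1 ⟨(h : Field.absoluteGaloisGroup K), κ.kerSubgroup_le_layerSubgroup 0 h.2⟩ := by
      rw [contOneCocycles.pullback_apply]; rfl
    have h1 := hR₀ h
    rw [Submodule.coe_sub, ContinuousMap.sub_apply, hpb, sub_eq_iff_eq_add, discreteTopRep_ρ_apply,
      Subgroup.smul_def] at h1
    rw [h1, add_comm]
  -- a power of `p` killing `R₀`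
  obtain ⟨m₀, hm₀⟩ : ∃ m₀ : ℕ, p ^ m₀ • R₀ = 0 := by
    obtain ⟨m, hm⟩ := AddCommGroup.mem_primaryComponent.mp R₀.2
    exact ⟨m, Subtype.ext (by rw [AddSubmonoidClass.coe_nsmul, hm, ZeroMemClass.coe_zero])⟩
  -- the corrected point `Q₁`, exponent `k' = k + m₀`, `x' = p^{k'} Q₁ = p^{m₀} (p^k Q) ∈ A ≤ M`
  set R₀' : localPoints W E := pointsMapOfEmb W ι ((R₀ : W.geomPrimaryTorsion p) : W.geomPoints) with hR₀'
  have hR₀'tors : p ^ m₀ • R₀' = 0 := by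
    rw [hR₀', ← map_nsmul, ← AddSubmonoidClass.coe_nsmul, hm₀, ZeroMemClass.coe_zero, map_zero]
  set Q₁ : localPoints W E := Q - R₀' with hQ₁
  set k' : ℕ := k + m₀ with hk'
  set x' : localPoints W E := p ^ k' • Q₁ with hx'
  have hx'eq : x' = p ^ m₀ • (p ^ k • Q) := by
    have e1 : p ^ k' • R₀' = 0 := by rw [hk', pow_add, mul_smul, hR₀'tors, smul_zero]
    rw [hx', hQ₁, smul_sub, e1, sub_zero, hk', pow_add, mul_comm, mul_smul]
  have hx'A : x' ∈ A := by rw [hx'eq]; exact AddSubgroup.nsmul_mem _ hQA _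
  have hx'M : x' ∈ M := hAM hx'A
  -- `f τ = τ Q₁ − Q₁` on `G_∞`
  have hfcob : ∀ τ : Field.absoluteGaloisGroup E, τ ∈ localSubgroupOfEmb κ.kerSubgroup ι →
      f τ = τ • Q₁ - Q₁ := by
    intro τ hτ
    have h1 := hcob ⟨τ, hτ⟩
    change pointsMapOfEmb W ι _ = τ • Q - Q at h1
    have h2 := hφΦ (resGalSubgroupOfEmb κ.kerSubgroup ι ⟨τ, hτ⟩)
    have h3 : f τ = pointsMapOfEmb W ι ((Φ.1
        ⟨((resGalSubgroupOfEmb κ.kerSubgroup ι ⟨τ, hτ⟩ : κ.kerSubgroup) : Field.absoluteGaloisGroup K),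
          κ.kerSubgroup_le_layerSubgroup 0 (resGalSubgroupOfEmb κ.kerSubgroup ι ⟨τ, hτ⟩).2⟩ :
        W.geomPrimaryTorsion p) : W.geomPoints) := rfl
    have h4 : Φ.1 ⟨((resGalSubgroupOfEmb κ.kerSubgroup ι ⟨τ, hτ⟩ : κ.kerSubgroup) :
          Field.absoluteGaloisGroup K),
          κ.kerSubgroup_le_layerSubgroup 0 (resGalSubgroupOfEmb κ.kerSubgroup ι ⟨τ, hτ⟩).2⟩ =
        φ.1 (resGalSubgroupOfEmb κ.kerSubgroup ι ⟨τ, hτ⟩) -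
          (((resGalSubgroupOfEmb κ.kerSubgroup ι ⟨τ, hτ⟩ : κ.kerSubgroup) :
            Field.absoluteGaloisGroup K) • R₀ - R₀) := by
      rw [h2]; abel
    rw [h3, h4, AddSubgroup.coe_sub, map_sub, h1, AddSubgroup.coe_sub, map_sub,
      primaryComponent.coe_smul, resGalSubgroupOfEmb_apply_coe, pointsMapOfEmb_smul, hQ₁, smul_sub]
    abel
  -- Step 2: invariance — for every `σ`, `w_σ := σ Q₁ − Q₁ − f σ ∈ M` and `σ x' − x' = p^{k'} w_σ`
  have hwM : ∀ σ : Field.absoluteGaloisGroup E, σ • Q₁ - Q₁ - f σ ∈ M := by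
    intro σ
    rw [hM, mem_localTowerPointsOfEmb_iff]
    intro τ hτ
    have hτ' := hconj σ τ hτ
    -- `f (τ σ) = f τ + τ f σ` and `τ σ = σ (σ⁻¹ τ σ)`
    have e1 : f (τ * σ) = f τ + τ • f σ := hfmul τ σ
    have e2 : f (τ * σ) = f σ + σ • f (σ⁻¹ * τ * σ) := by
      rw [show τ * σ = σ * (σ⁻¹ * τ * σ) by group]; exact hfmul σ _
    rw [hfcob τ hτ] at e1
    rw [hfcob _ hτ', smul_sub, ← mul_smul, show σ * (σ⁻¹ * τ * σ) = τ * σ by group, mul_smul] at e2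
    have key := e1.symm.trans e2
    rw [smul_sub, smul_sub]
    calc τ • σ • Q₁ - τ • Q₁ - τ • f σ
        = τ • σ • Q₁ - (τ • Q₁ - Q₁ + τ • f σ) - Q₁ := by abel
      _ = τ • σ • Q₁ - (f σ + (τ • σ • Q₁ - σ • Q₁)) - Q₁ := by rw [key]
      _ = σ • Q₁ - Q₁ - f σ := by abel
  have hσx' : ∀ σ : Field.absoluteGaloisGroup E, σ • x' - x' = p ^ k' • (σ • Q₁ - Q₁ - f σ) := by
    intro σ
    -- `p^{k'} w_σ = σ x' − x' − p^{k'} f σ`, and `p^{k'} f σ ∈ M` is `p`-power torsion, hence `0`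
    have e1 : p ^ k' • (σ • Q₁ - Q₁ - f σ) = σ • x' - x' - p ^ k' • f σ := by
      rw [smul_sub, smul_sub, hx', galois_smul_nsmul_inj]
    have htM : p ^ k' • f σ ∈ M := by
      have : p ^ k' • f σ = σ • x' - x' - p ^ k' • (σ • Q₁ - Q₁ - f σ) := by rw [e1]; abel
      rw [this]
      exact sub_mem (sub_mem (hMsmul σ hx'M) hx'M) (AddSubgroup.nsmul_mem _ (hwM σ) _)
    have ht0 : p ^ k' • f σ = 0 :=
      eq_zero_of_pow_smul_eq_zero_inj W κ E hnt htM (m := N) (by rw [smul_comm, hfN, smul_zero])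
    rw [e1, ht0, sub_zero]
  -- Steps 3–4 replaced by (LIFT_A): `x' = p^{k'} R + x₀`, `R ∈ M`, `x₀ ∈ E(K_v)`
  obtain ⟨R, hRM, hx₀⟩ := hlift x' hx'A k' (fun σ ↦ ⟨σ • Q₁ - Q₁ - f σ, hwM σ, hσx' σ⟩)
  set x₀ : localPoints W E := x' - p ^ k' • R with hx₀def
  have hx₀0 : x₀ ∈ localLayerPointsOfEmb κ ι W 0 := hx₀
  -- Step 5: descent — `Q' := Q₁ − R`, `p^{k'} Q' = x₀`, and `f = ∂Q'` on all of `Γ_{K_v}`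
  set Q' : localPoints W E := Q₁ - R with hQ'
  have hQ'k : p ^ k' • Q' = x₀ := by rw [hQ', smul_sub, ← hx', hx₀def]
  have hfcob' : ∀ τ : Field.absoluteGaloisGroup E, τ ∈ localSubgroupOfEmb κ.kerSubgroup ι →
      f τ = τ • Q' - Q' := by
    intro τ hτ
    rw [hfcob τ hτ, hQ', smul_sub τ Q₁ R, hMfix hRM τ hτ]
    abel
  have hfall : ∀ σ : Field.absoluteGaloisGroup E, f σ = σ • Q' - Q' := by
    intro σ
    -- `ψ := f σ − (σ Q' − Q')` is `G_∞`-fixed …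
    have hψM : f σ - (σ • Q' - Q') ∈ M := by
      rw [hM, mem_localTowerPointsOfEmb_iff]
      intro τ hτ
      have hτ' := hconj σ τ hτ
      have e1 : f (τ * σ) = f τ + τ • f σ := hfmul τ σ
      have e2 : f (τ * σ) = f σ + σ • f (σ⁻¹ * τ * σ) := by
        rw [show τ * σ = σ * (σ⁻¹ * τ * σ) by group]; exact hfmul σ _
      rw [hfcob' τ hτ] at e1
      rw [hfcob' _ hτ', smul_sub, ← mul_smul, show σ * (σ⁻¹ * τ * σ) = τ * σ by group, mul_smul] at e2
      have key := e1.symm.trans e2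
      rw [smul_sub, smul_sub]
      calc τ • f σ - (τ • σ • Q' - τ • Q')
          = (τ • Q' - Q' + τ • f σ) - τ • σ • Q' + Q' := by abel
        _ = (f σ + (τ • σ • Q' - σ • Q')) - τ • σ • Q' + Q' := by rw [key]
        _ = f σ - (σ • Q' - Q') := by abel
    -- … and `p`-power torsion: `p^{k'} ψ = p^{k'} f σ` (as `σ x₀ = x₀`), killed by `p^N`
    have hψtors : p ^ (N + k') • (f σ - (σ • Q' - Q')) = 0 := by
      have e1 : p ^ k' • (f σ - (σ • Q' - Q')) = p ^ k' • f σ := by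
        rw [smul_sub, smul_sub, ← galois_smul_nsmul_inj, hQ'k, (hM0.mp hx₀0) σ, sub_self, sub_zero]
      rw [pow_add, mul_smul, e1, smul_comm, hfN, smul_zero]
    exact sub_eq_zero.mp (eq_zero_of_pow_smul_eq_zero_inj W κ E hnt hψM hψtors)
  -- conclusion: `loc_v y` is the coboundary of `Q'`
  refine localKummerOverOfEmb_le_localKerOverOfEmb (localLayerPointsOfEmb κ ι W 0) ⟨Φ, Q', k', rfl,
    by rw [hQ'k]; exact hx₀0, fun τ ↦ ?_⟩
  exact hfall τ

/-! ## §3 The dual form of (LIFT_A): divisibility under every functional vanishing on `E(K_v)` -/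

omit [NumberField K] in
/-- **(LIFT_A) from its dual form** (step (4) of the template, «Taking Pontryagin duals»): let `M = E(K_∞·K_v)` have no
`p`-torsion (NT). If for every `x ∈ A` and `k`, the `Γ_{K_v}`-invariance of `x ⊗ p^{-k}` (`σx − x ∈ p^k M` for all `σ`)
forces `p^k ∣ z(x)` for EVERY additive `z : M →+ ℤ_p` vanishing on `E(K_v)`, then it forces `x ∈ p^k M + E(K_v)`:
Pontryagin separation in the `p`-torsion-free group `M / E(K_v)` (torsion-free by (NT): `p n̄ = 0 ⇒ σn − n` is
`p`-torsion in `M`), `Literature.Algebra.Module.exists_nsmul_eq_of_forall_addMonoidHom_padicInt_dvd`.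
[cite: Sprung2024, §5.2 proof of Lemma 5.5, case v = p (p. 40), «Taking Pontryagin duals»]
[cite: BDKim2013, proof of Cor. 3.15 (p. 199)] -/
theorem invariantsLift_of_forall_addMonoidHom_dvd
    (ι : AlgebraicClosure K →ₐ[K] AlgebraicClosure E)
    (A : AddSubgroup (localPoints W E)) (hAM : A ≤ localTowerPointsOfEmb κ ι W)
    (hnt : ∀ P ∈ localTowerPointsOfEmb κ ι W, p • P = 0 → P = 0)
    (hdiv : ∀ x ∈ A, ∀ k : ℕ,
      (∀ σ : Field.absoluteGaloisGroup E, ∃ w ∈ localTowerPointsOfEmb κ ι W, σ • x - x = p ^ k • w) →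
      ∀ z : localTowerPointsOfEmb κ ι W →+ ℤ_[p],
        (∀ (x₀ : localPoints W E) (hx₀ : x₀ ∈ localLayerPointsOfEmb κ ι W 0),
          z ⟨x₀, localLayerPointsOfEmb_le_localTowerPointsOfEmb κ ι W 0 hx₀⟩ = 0) →
        ∀ hx : x ∈ localTowerPointsOfEmb κ ι W, (p : ℤ_[p]) ^ k ∣ z ⟨x, hx⟩) :
    ∀ x ∈ A, ∀ k : ℕ,
      (∀ σ : Field.absoluteGaloisGroup E, ∃ w ∈ localTowerPointsOfEmb κ ι W, σ • x - x = p ^ k • w) →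
      ∃ R ∈ localTowerPointsOfEmb κ ι W, x - p ^ k • R ∈ localLayerPointsOfEmb κ ι W 0 := by
  intro x hxA k hinv
  set M : AddSubgroup (localPoints W E) := localTowerPointsOfEmb κ ι W with hM
  have hxM : x ∈ M := hAM hxA
  have hle0 : localLayerPointsOfEmb κ ι W 0 ≤ M := localLayerPointsOfEmb_le_localTowerPointsOfEmb κ ι W 0
  have hM0 : ∀ {P : localPoints W E}, P ∈ localLayerPointsOfEmb κ ι W 0 ↔
      ∀ τ : Field.absoluteGaloisGroup E, τ • P = P := fun {P} ↦ mem_localLayerPointsOfEmb_zero_iff κ ι W P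
  have hMsmul : ∀ (σ : Field.absoluteGaloisGroup E) {P : localPoints W E}, P ∈ M → σ • P ∈ M :=
    fun σ {P} hP ↦ smul_mem_localTowerPointsOfEmb κ ι W σ hP
  -- Pontryagin separation in `M / E(K_v)`
  set M₀' : AddSubgroup M := (localLayerPointsOfEmb κ ι W 0).addSubgroupOf M with hM₀'
  have hM₀'mem : ∀ {m : M}, m ∈ M₀' ↔ (m : localPoints W E) ∈ localLayerPointsOfEmb κ ι W 0 :=
    fun {m} ↦ AddSubgroup.mem_addSubgroupOf
  have hNtf : ∀ n : M ⧸ M₀', p • n = 0 → n = 0 := by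
    intro n hn
    induction n using QuotientAddGroup.induction_on with
    | H m =>
      rw [← QuotientAddGroup.mk_nsmul, QuotientAddGroup.eq_zero_iff, hM₀'mem, hM0] at hn
      rw [QuotientAddGroup.eq_zero_iff, hM₀'mem, hM0]
      intro τ
      have hd : τ • (m : localPoints W E) - m ∈ M := sub_mem (hMsmul τ m.2) m.2
      have hpd : p • (τ • (m : localPoints W E) - m) = 0 := by
        rw [smul_sub, ← galois_smul_nsmul_inj, ← AddSubmonoidClass.coe_nsmul, hn τ, sub_self]
      exact sub_eq_zero.mp (hnt _ hd hpd)
  have hsep : ∀ z' : M ⧸ M₀' →+ ℤ_[p], (p : ℤ_[p]) ^ k ∣ z' (QuotientAddGroup.mk ⟨x, hxM⟩) := by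
    intro z'
    have h := hdiv x hxA k hinv (z'.comp (QuotientAddGroup.mk' M₀')) (fun x₀ hx₀ ↦ by
      rw [AddMonoidHom.comp_apply, QuotientAddGroup.mk'_apply,
        (QuotientAddGroup.eq_zero_iff _).mpr (hM₀'mem.mpr hx₀), map_zero]) hxM
    exact h
  obtain ⟨yq, hyq⟩ := Literature.Algebra.Module.exists_nsmul_eq_of_forall_addMonoidHom_padicInt_dvd hNtf hsep
  obtain ⟨R, rfl⟩ := QuotientAddGroup.mk_surjective yq
  rw [← QuotientAddGroup.mk_nsmul, QuotientAddGroup.eq, hM₀'mem] at hyq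
  -- `x₀ := −p^k R + x ∈ E(K_v)`
  refine ⟨R, R.2, ?_⟩
  have : ((-(p ^ k • R) + ⟨x, hxM⟩ : M) : localPoints W E) = x - p ^ k • (R : localPoints W E) := by
    rw [AddSubgroup.coe_add, AddSubgroup.coe_neg, AddSubmonoidClass.coe_nsmul]; abel
  rw [← this]; exact hyq

/-! ## §4 The chosen embedding: `loc_v y = 0` -/

/-- **«`r_v^ε` is injective», chosen-embedding form.** For the chosen embedding `closureEmb` (`E = K_v`), under (NT)
and (LIFT_A) for `A ≤ E(K_∞·K_v)`, every `y ∈ H¹(K, E[p^∞])` whose restriction to `K_∞` is Kummer-from-`A` at `𝔭`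
has `loc_v y = 0` in `H¹(K_v, E)`: `W.localResOver p (κ.layerSubgroup 0) E y = 0` (`mem_localKerOver_iff`,
`localKerOver_eq_ofEmb`). [cite: Sprung2024, §5.2 proof of Lemma 5.5, case v = p (p. 40)]
[cite: BDKim2013, proof of Cor. 3.15 (p. 199)] -/
theorem localResOver_eq_zero_of_layerToInfty_mem_localKummerOver_of_invariantsLift
    (A : AddSubgroup (localPoints W E)) (hAM : A ≤ localTowerPointsOfEmb κ (closureEmb (K := K) E) W)
    (hnt : ∀ P ∈ localTowerPointsOfEmb κ (closureEmb (K := K) E) W, p • P = 0 → P = 0)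
    (hlift : ∀ x ∈ A, ∀ k : ℕ,
      (∀ σ : Field.absoluteGaloisGroup E,
        ∃ w ∈ localTowerPointsOfEmb κ (closureEmb (K := K) E) W, σ • x - x = p ^ k • w) →
      ∃ R ∈ localTowerPointsOfEmb κ (closureEmb (K := K) E) W,
        x - p ^ k • R ∈ localLayerPointsOfEmb κ (closureEmb (K := K) E) W 0)
    {y : W.subgroupH1 p (κ.layerSubgroup 0)}
    (hy : W.layerToInfty κ 0 y ∈ localKummerOverOfEmb W p κ.kerSubgroup (closureEmb (K := K) E) A) :
    W.localResOver p (κ.layerSubgroup 0) E y = 0 := by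
  rw [← W.mem_localKerOver_iff p (κ.layerSubgroup 0), W.localKerOver_eq_ofEmb p (κ.layerSubgroup 0)]
  exact mem_localKerOverOfEmb_of_layerToInfty_mem_localKummerOverOfEmb_of_invariantsLift W κ E
    (closureEmb (K := K) E) A hAM hnt hlift hy

end Summit.BirchSwinnertonDyer.BirchSwinnertonDyer.Theorems.SignedEC

end
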